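import Literature.MathematicalPhysics.PowerSystems.DroopSyncExponentialStability
import HarnessLib

/-!
# Local exponential stability of the DAPI-controlled droop network — Simpson-Porco–Dörfler–Bullo
# 2013, Theorem 8 (ii) (stability clause), all-inverter networks

Topic `Literature/MathematicalPhysics/PowerSystems` (LADDER-GRIDFUSION rung G3 «inverter-based /
low-inertia», secondary frequency control; seat gridfusion-lit-2, g9).  Companion of
`DroopSyncExponentialStability.lean` (primary droop control, Theorem 2).  Everything is PROVED (no
named fact, no `sorry`), through Lyapunov's indirect method in the rotation-quotient form
(`Literature/Analysis/ODE/LyapunovIndirectMethod.lean`).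

SOURCE (held LaTeX text of arXiv:1206.5033 = Automatica 49 (2013) 2603–2611, read on the page this
session) [SimpsonporcoDorflerBullo2013]:
* §5, the distributed-averaging proportional-integral (DAPI) controller (p0012 L14–L31):
  «`D_i θ̇_i = P_i^* − p_i − P_e,i`, `k_i ṗ_i = D_i θ̇_i − Σ_{j∈V_I} L_c,ij (p_i/D_i − p_j/D_j)` …
  `k_i > 0` is a gain … `L_c` the Laplacian matrix corresponding to a weighted, undirected and
  connected communication graph»; closed loop (p0012 L36–L50).
* **Theorem 8 (Stability of DAPI-Controlled Network)** (p0012 L56–L67): «(ii) Stability of DAPI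
  Controller: There exists an arc length `γ ∈ [0,π/2[` such that the system … possess a locally
  exponentially stable and unique equilibrium `(θ*, p*) ∈ Δ_G(γ) × ℝ^{|V_I|}`. … the unique
  equilibrium is given as in Theorem 2 (ii), along with `p*_i = D_i ω_avg`.»
* App. C, proof (p0016 L1–L40): error coordinates `p̃ = p − Dω_avg`; «`J(θ*, p̃*) = −Z^{−1}X`»,
  `X = X₁X₂`, `X₁ = [[D⁻¹, I],[I, L_c + D]] ⪰ 0` with kernel `(−D𝟙, 𝟙)`, `X₂ = blkdiag(L_red(θ*),
  D⁻¹) ⪰ 0` with kernel the rotation, `Z = blkdiag(I, K)`; «all eigenvalues are real and negative …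
  modulo rotational symmetry» (continuity argument in `ε`).

WHAT IS PROVED, for `W : DAPINetwork n` (droop data + gains `k_i` + communication weights `c_ij`),
all-inverter network (`V_L = ∅`):
* §1 `IsSolutionAt` (the closed loop as printed), `dapiField` (error coordinates), `dapiJac`,
  `rot = (𝟙, 0)`, `weights = (D, −k)`, row lemmas, `dapiField_add_rot` (rotational symmetry),
  **`weights_dotProduct_dapiField`** (conserved quantity `Σ D_iθ_i − Σ k_ip̃_i` — its derivative is
  `Σ_i (L_cD⁻¹p̃)_i = 0`), `dapiField_equilibrium` (`(θ*, p̃ = 0)`), **`hasFDerivAt_dapiField`**;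
* §2 **`dapiJac_eig_re_neg_or_rotation`** — the spectral sentence, proved WITHOUT the continuity
  argument: for an eigenpair `(μ, v)`, with `w = X₂v`, the Hermitian identity
  `⟨w, X₁w⟩ = −μ ⟨X₂v, Zv⟩`, `⟨w, X₁w⟩ = Σ_i |w₁,i + D_iw₂,i|²/D_i + w₂^*L_cw₂ ≥ 0`,
  `⟨X₂v, Zv⟩ = v₁^*L(θ*)v₁ + Σ_i k_iD_i|w₂,i|² ≥ 0`, and the two kernel certificates give `Re μ < 0`
  or the rotation mode;
* §3 `commForm_certificate_of_connected`, `expStable_within_leaf`,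
  `expStable_modRotation_of_within_leaf`, `hasDerivAt_phase_of_isSolutionAt`,
  **`equilibrium_locally_expStable_of_certificates`** (PSD + kernel certificates for `L(θ*)` and
  `L_c`, so `θ*` outside the arc is allowed) and **`equilibrium_locally_expStable`** (the printed
  hypotheses: `θ* ∈ Δ_G(γ)`, `γ < π/2`, `a ≥ 0` connected, `c ≥ 0` connected): `∃ ρ, k, λ > 0`,
  every solution `(θ, p)` with `‖(θ(0) − θ*, p(0) − Dω_avg)‖ < ρ` satisfies
  `‖(θ(t) − (θ* + c𝟙), p(t) − Dω_avg)‖ ≤ k‖(θ(0) − (θ* + c𝟙), p(0) − Dω_avg)‖e^{−λt}` for `t ≥ 0`,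
  `c = (Σ D_i(θ_i(0) − θ*_i) − Σ k_i(p_i(0) − D_iω_avg))/Σ D_i`.

THREE COLUMNS.  Mathematics about MODEL «droop-controlled inverters with the DAPI secondary loop
(eqs. (primary control)–(secondary control)), `V_L = ∅`, lossless inductive lines, constant voltage
amplitudes».  `ρ, k, λ` are EXISTENTIAL.  Nothing here says a microgrid is stable.

## Not here

Load nodes (`V_L ≠ ∅`, the DAE and `L_red`); the equivalence (i) ⇔ (ii), the description and
uniqueness of the equilibrium and the power-sharing clause — the ALGEBRAIC part of Theorem 8 is
already typed in `DroopControlledInverters.lean` §5 (`DroopNetwork.IsDAPIEquilibrium`,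
`isDAPIEquilibrium_iff` («given as in Theorem 2 (ii), along with `p*_i = D_iω_avg`»),
`exists_isDAPIEquilibrium_iff`, `dapi_powerSharing`, `CommConnected`), whose docstrings record
«local exponential stability NOT typed» — this file types it (`V_L = ∅`); time delays / discrete
communication.

## Mathlib / tree search

Tree: `DroopNetwork.{auxField, auxJac, lap, linWeight, lap_mulVec, auxJac_mulVec, linWeight_symm,
auxField_add_const, auxField_eq_zero_of_isAuxEquilibrium, hasFDerivAt_auxField, re_conj_lapForm,
lapForm_eq_half_sum, posCurvature_of_arc}` (`DroopSyncExponentialStability.lean`),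
`ClassicalModel.{CouplingConnected, exists_const_of_lineAngles_eq}`,
`Literature.Analysis.ODE.exists_expStable_within_of_eig_re_neg_or_smul` (used);
`DroopNetwork.{IsDAPIEquilibrium, isDAPIEquilibrium_iff, CommConnected}`
(`DroopControlledInverters.lean` §5: the closed loop's rest points; same equations as `IsSolutionAt`
here with `A_c = comm`, all nodes inverters).  Mathlib:
`Matrix.fromBlocks_mulVec`, `Matrix.fromBlocks_apply₁₁…₂₂`, `Fintype.sum_sum_type`,
`hasFDerivAt_pi'`, `HasFDerivAt.comp`, `Complex.conj_mul'` (used).  `lean search 'DAPI|distributed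
averaging|secondary control'`: nothing in the tree before this file.

## References

* J. W. Simpson-Porco, F. Dörfler, F. Bullo, *Synchronization and power sharing for droop-controlled
  inverters in islanded microgrids*, Automatica 49 (2013) 2603–2611 = arXiv:1206.5033, §5 and
  Theorem 8 with App. C (held text p0012, p0016). [SimpsonporcoDorflerBullo2013]
* H. K. Khalil, *Nonlinear Systems*, 3rd ed., Theorem 4.7. [Khalil2002]
-/

noncomputable section

open Set Filter Topology Finset
open scoped Matrix ComplexConjugate BigOperators

namespace Literature.MathematicalPhysics.PowerSystems

/-- A droop-controlled all-inverter network with the distributed-averaging proportional-integral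
(DAPI) secondary controller: the droop data (`Dc`, `P*`, `E`, `|Y|`), integral gains `k_i`, and the
weights `c_ij` of the communication graph `G_c` between the inverters.
[cite: SimpsonporcoDorflerBullo2013, §5 eqs. (primary control)–(secondary control) («`k_i > 0` is a
gain … `L_c` the Laplacian matrix corresponding to a weighted, undirected and connected communication
graph»)] -/
structure DAPINetwork (n : ℕ) extends DroopNetwork n where
  /-- the integral gains `k_i` -/
  kgain : Fin n → ℝ
  /-- the communication weights `A_c = (c_ij)` -/
  comm : Fin n → Fin n → ℝ

namespace DAPINetwork

variable {n : ℕ} (W : DAPINetwork n)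

/-! ## §1 The closed loop, its solutions, the error coordinates and the Jacobian -/

/-- **Solutions of the DAPI closed loop** (all-inverter network, `V_L = ∅`), componentwise at time
`t`: `D_i θ̇_i = P*_i − p_i − P_e,i(θ)` and
`k_i ṗ_i = P*_i − p_i − P_e,i(θ) − Σ_j c_ij (p_i/D_i − p_j/D_j)` (the printed
`L_c D⁻¹ p` written with the adjacency weights).
[cite: SimpsonporcoDorflerBullo2013, §5 eqs. (primary control – closed loop)–(secondary control – closed loop)] -/
def IsSolutionAt (θ p : ℝ → Fin n → ℝ) (t : ℝ) : Prop :=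
  ∀ i, HasDerivAt (fun s => θ s i) ((W.Pstar i - p t i - W.injection (θ t) i) / W.Dc i) t ∧
    HasDerivAt (fun s => p s i)
      ((W.Pstar i - p t i - W.injection (θ t) i
        - ∑ j, W.comm i j * (p t i / W.Dc i - p t j / W.Dc j)) / W.kgain i) t

/-- The state `(θ, p̃)` as one function on `Fin n ⊕ Fin n` (angles left, power variables right; sup
norm). [cite: SimpsonporcoDorflerBullo2013, App. C (proof of Theorem 8), error coordinates `p̃ = p − D ω_avg`] -/
def phase (θ q : Fin n → ℝ) : Fin n ⊕ Fin n → ℝ := Sum.elim θ q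

/-- **The closed loop in the error coordinates `p̃_i = p_i − D_iω_avg`** (App. C eq. (rot2)):
`θ̇_i = (P̃_i − P_e,i(θ) − p̃_i)/D_i`, `p̃'_i = (P̃_i − P_e,i(θ) − p̃_i − Σ_j c_ij(p̃_i/D_i − p̃_j/D_j))/k_i`,
`P̃_i − P_e,i(θ) = D_i · auxField_i(θ)` (the (Aux) field of Theorem 2).
[cite: SimpsonporcoDorflerBullo2013, App. C eqs. (load – closed loop – rot2)–(secondary control – closed loop – rot2)] -/
def dapiField (x : Fin n ⊕ Fin n → ℝ) : Fin n ⊕ Fin n → ℝ :=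
  Sum.elim (fun i => W.auxField (fun j => x (Sum.inl j)) i - x (Sum.inr i) / W.Dc i)
    (fun i => (W.Dc i * W.auxField (fun j => x (Sum.inl j)) i - x (Sum.inr i)
      - ∑ j, W.comm i j * (x (Sum.inr i) / W.Dc i - x (Sum.inr j) / W.Dc j)) / W.kgain i)

/-- The rotation mode `(𝟙, 0)`. [cite: SimpsonporcoDorflerBullo2013, App. C («modulo rotational symmetry»)] -/
def rot : Fin n ⊕ Fin n → ℝ := Sum.elim (fun _ => 1) (fun _ => 0)

/-- The weights `(D, −k)` of the conserved quantity `Σ_i D_iθ_i − Σ_i k_ip̃_i`. [folklore] -/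
def weights : Fin n ⊕ Fin n → ℝ := Sum.elim W.Dc (fun i => -W.kgain i)

/-- The Laplacian of the communication graph, nodally: `(L_c y)_i = Σ_j c_ij (y_i − y_j)`.
[cite: SimpsonporcoDorflerBullo2013, §5 («`L_c` … the Laplacian matrix»)] -/
def commLap : Matrix (Fin n) (Fin n) ℝ :=
  fun i j => (if i = j then ∑ k, W.comm i k else 0) - W.comm i j

/-- **The Jacobian of the closed loop at `(θ*, 0)`** in the error coordinates:
`[[−D⁻¹L(θ*), −D⁻¹], [−K⁻¹L(θ*), −K⁻¹(I + L_cD⁻¹)]] = −Z⁻¹X₁X₂`.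
[cite: SimpsonporcoDorflerBullo2013, App. C («`J(θ*, p̃*) = −Z⁻¹X`», `X = X₁X₂`)] -/
def dapiJac (θs : Fin n → ℝ) : Matrix (Fin n ⊕ Fin n) (Fin n ⊕ Fin n) ℝ :=
  Matrix.fromBlocks (W.auxJac θs) (Matrix.diagonal fun i => -1 / W.Dc i)
    (fun i j => -W.lap θs i j / W.kgain i)
    (fun i j => -((if i = j then 1 else 0) + W.commLap i j / W.Dc j) / W.kgain i)

variable {W}

/-- `(L_c y)_i = Σ_j c_ij (y_i − y_j)`. [cite: SimpsonporcoDorflerBullo2013, §5] -/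
theorem commLap_mulVec (y : Fin n → ℝ) (i : Fin n) :
    (W.commLap *ᵥ y) i = ∑ j, W.comm i j * (y i - y j) := by
  simp only [Matrix.mulVec, dotProduct, commLap, sub_mul, Finset.sum_sub_distrib, ite_mul, zero_mul,
    Finset.sum_ite_eq, Finset.mem_univ, if_true, mul_sub, Finset.sum_mul]

/-- The printed form of the `p`-rows: `D_i·auxField_i(θ) = P̃_i − P_e,i(θ)` (`D_i ≠ 0`).
[cite: SimpsonporcoDorflerBullo2013, §3 eq. (Aux) and App. C eq. (rot2)] -/
theorem dc_mul_auxField (hD : ∀ i, W.Dc i ≠ 0) (θ : Fin n → ℝ) (i : Fin n) :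
    W.Dc i * W.auxField θ i = W.shiftedInjection i - W.injection θ i := by
  unfold DroopNetwork.auxField
  field_simp [hD i]

/-- Rotational symmetry: a uniform shift of all angles does not change the field.
[cite: SimpsonporcoDorflerBullo2013, App. C («modulo rotational symmetry»)] -/
theorem dapiField_add_rot (x : Fin n ⊕ Fin n → ℝ) (c : ℝ) :
    W.dapiField (fun kk => x kk + c * rot kk) = W.dapiField x := by
  have h0 : (fun j => x (Sum.inl j) + c * rot (Sum.inl j)) = fun j => x (Sum.inl j) + c :=
    funext fun j => by simp [rot]
  have h1 : W.auxField (fun j => x (Sum.inl j) + c * rot (Sum.inl j))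
      = W.auxField (fun j => x (Sum.inl j)) := by
    rw [h0]
    exact DroopNetwork.auxField_add_const (N := W.toDroopNetwork) _ c
  funext kk
  cases kk with
  | inl i =>
    show W.auxField (fun j => x (Sum.inl j) + c * rot (Sum.inl j)) i
        - (x (Sum.inr i) + c * rot (Sum.inr i)) / W.Dc i
      = W.auxField (fun j => x (Sum.inl j)) i - x (Sum.inr i) / W.Dc i
    rw [h1]
    simp [rot]
  | inr i =>
    show (W.Dc i * W.auxField (fun j => x (Sum.inl j) + c * rot (Sum.inl j)) i
        - (x (Sum.inr i) + c * rot (Sum.inr i))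
        - ∑ j, W.comm i j * ((x (Sum.inr i) + c * rot (Sum.inr i)) / W.Dc i
          - (x (Sum.inr j) + c * rot (Sum.inr j)) / W.Dc j)) / W.kgain i
      = (W.Dc i * W.auxField (fun j => x (Sum.inl j)) i - x (Sum.inr i)
        - ∑ j, W.comm i j * (x (Sum.inr i) / W.Dc i - x (Sum.inr j) / W.Dc j)) / W.kgain i
    rw [h1]
    simp [rot]

/-- **The conserved quantity** `Σ_i D_iθ_i − Σ_i k_ip̃_i`: along the closed loop its derivative is
`Σ_i (L_cD⁻¹p̃)_i = 0` (symmetric communication weights, `D_i ≠ 0`) — the left null vector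
`(D𝟙, −𝟙)ᵀX₁ = 0` of the printed factorisation `J = −Z⁻¹X₁X₂`, read through `Z = blkdiag(I, K)`.
[cite: SimpsonporcoDorflerBullo2013, App. C (proof of Theorem 8: «`X₁` is positive semidefinite with
kernel spanned by `(−D_I𝟙, 𝟙)`», «modulo rotational symmetry»)] -/
theorem weights_dotProduct_dapiField (hD : ∀ i, W.Dc i ≠ 0) (hk : ∀ i, W.kgain i ≠ 0)
    (hc : ∀ i j, W.comm i j = W.comm j i) (x : Fin n ⊕ Fin n → ℝ) :
    W.weights ⬝ᵥ W.dapiField x = 0 := by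
  have h2 : ∀ i, -W.kgain i * W.dapiField x (Sum.inr i)
      = -(W.Dc i * W.auxField (fun j => x (Sum.inl j)) i - x (Sum.inr i)
        - ∑ j, W.comm i j * (x (Sum.inr i) / W.Dc i - x (Sum.inr j) / W.Dc j)) := by
    intro i
    simp only [dapiField, Sum.elim_inr]
    field_simp [hk i]
  have h1 : ∀ i, W.Dc i * W.dapiField x (Sum.inl i)
      = W.Dc i * W.auxField (fun j => x (Sum.inl j)) i - x (Sum.inr i) := by
    intro i
    simp only [dapiField, Sum.elim_inl, mul_sub, mul_div_cancel₀ _ (hD i)]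
  have hanti : ∑ i, ∑ j, W.comm i j * (x (Sum.inr i) / W.Dc i - x (Sum.inr j) / W.Dc j) = 0 := by
    have hswap : ∑ i, ∑ j, W.comm i j * (x (Sum.inr i) / W.Dc i - x (Sum.inr j) / W.Dc j)
        = ∑ i, ∑ j, W.comm j i * (x (Sum.inr j) / W.Dc j - x (Sum.inr i) / W.Dc i) :=
      Finset.sum_comm
    have hneg : ∑ i, ∑ j, W.comm j i * (x (Sum.inr j) / W.Dc j - x (Sum.inr i) / W.Dc i)
        = -∑ i, ∑ j, W.comm i j * (x (Sum.inr i) / W.Dc i - x (Sum.inr j) / W.Dc j) := by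
      rw [← Finset.sum_neg_distrib]
      refine Finset.sum_congr rfl fun i _ => ?_
      rw [← Finset.sum_neg_distrib]
      refine Finset.sum_congr rfl fun j _ => ?_
      rw [hc j i]; ring
    linarith
  simp only [dotProduct, Fintype.sum_sum_type, weights, Sum.elim_inl, Sum.elim_inr, h1, h2,
    Finset.sum_neg_distrib, Finset.sum_sub_distrib, hanti]
  ring

/-- `Σ weights · (𝟙, 0) = Σ_i D_i`. [folklore] -/
private theorem weights_dotProduct_rot : W.weights ⬝ᵥ rot = ∑ i, W.Dc i := by
  simp [dotProduct, Fintype.sum_sum_type, weights, rot]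

/-- At an (Aux)-equilibrium `θ*` the closed loop rests at `(θ*, p̃ = 0)`, i.e. `p* = Dω_avg`.
[cite: SimpsonporcoDorflerBullo2013, Theorem 8 («the unique equilibrium is given as in Theorem 2 (ii), along with `p*_i = D_iω_avg`»)] -/
theorem dapiField_equilibrium {θs : Fin n → ℝ} (hθs : W.IsAuxEquilibrium θs) :
    W.dapiField (phase θs fun _ => 0) = 0 := by
  have h0 : W.auxField θs = 0 :=
    DroopNetwork.auxField_eq_zero_of_isAuxEquilibrium (N := W.toDroopNetwork) hθs
  funext kk
  cases kk with
  | inl i =>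
    simp only [dapiField, phase, Sum.elim_inl, Sum.elim_inr, zero_div, sub_zero, Pi.zero_apply]
    exact congrFun h0 i
  | inr i =>
    simp only [dapiField, phase, Sum.elim_inl, Sum.elim_inr, zero_div, sub_zero, mul_zero,
      Finset.sum_const_zero, Pi.zero_apply]
    rw [show (fun j => θs j) = θs from rfl, h0]
    simp

/-- Block rows of the Jacobian: `(J h)_θ,i = (−D⁻¹L h_θ)_i − h_p,i/D_i`.
[cite: SimpsonporcoDorflerBullo2013, App. C] -/
theorem dapiJac_mulVec_inl (θs : Fin n → ℝ) (h : Fin n ⊕ Fin n → ℝ) (i : Fin n) :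
    (W.dapiJac θs *ᵥ h) (Sum.inl i)
      = (W.auxJac θs *ᵥ fun j => h (Sum.inl j)) i - h (Sum.inr i) / W.Dc i := by
  simp only [dapiJac, Matrix.fromBlocks_mulVec, Sum.elim_inl, Pi.add_apply, Matrix.mulVec_diagonal,
    Function.comp_apply]
  have : (fun j => h (Sum.inl j)) = h ∘ Sum.inl := rfl
  rw [this]
  ring

/-- `(J h)_p,i = (−(L h_θ)_i − h_p,i − Σ_j c_ij(h_p,i/D_i − h_p,j/D_j))/k_i`.
[cite: SimpsonporcoDorflerBullo2013, App. C] -/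
theorem dapiJac_mulVec_inr (θs : Fin n → ℝ) (h : Fin n ⊕ Fin n → ℝ) (i : Fin n) :
    (W.dapiJac θs *ᵥ h) (Sum.inr i)
      = (-(∑ j, W.linWeight θs i j * (h (Sum.inl i) - h (Sum.inl j))) - h (Sum.inr i)
          - ∑ j, W.comm i j * (h (Sum.inr i) / W.Dc i - h (Sum.inr j) / W.Dc j)) / W.kgain i := by
  have hl : (W.lap θs *ᵥ (h ∘ Sum.inl)) i
      = ∑ j, W.linWeight θs i j * (h (Sum.inl i) - h (Sum.inl j)) := by
    rw [DroopNetwork.lap_mulVec]; rfl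
  have hc : (W.commLap *ᵥ fun j => h (Sum.inr j) / W.Dc j) i
      = ∑ j, W.comm i j * (h (Sum.inr i) / W.Dc i - h (Sum.inr j) / W.Dc j) := commLap_mulVec _ i
  rw [← hl, ← hc]
  simp only [dapiJac, Matrix.fromBlocks_mulVec, Sum.elim_inr, Pi.add_apply]
  simp only [Matrix.mulVec, dotProduct, Function.comp_apply]
  have h1 : ∀ j, -W.lap θs i j / W.kgain i * h (Sum.inl j)
      = (W.lap θs i j * h (Sum.inl j)) * (-(W.kgain i)⁻¹) := fun j => by ring
  have h2 : ∀ j, -((if i = j then (1 : ℝ) else 0) + W.commLap i j / W.Dc j) / W.kgain i * h (Sum.inr j)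
      = ((if i = j then h (Sum.inr j) else 0) + W.commLap i j * (h (Sum.inr j) / W.Dc j))
          * (-(W.kgain i)⁻¹) := fun j => by
    split_ifs <;> ring
  simp only [h1, h2, ← Finset.sum_mul, Finset.sum_add_distrib, Finset.sum_ite_eq, Finset.mem_univ,
    if_true]
  ring

/-- The projection `(θ, p̃) ↦ θ` as a continuous linear map. [folklore] -/
private def projL : (Fin n ⊕ Fin n → ℝ) →L[ℝ] (Fin n → ℝ) :=
  ContinuousLinearMap.pi fun j => ContinuousLinearMap.proj (Sum.inl j)

/-- `projL x = θ`. [folklore] -/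
private theorem projL_apply (x : Fin n ⊕ Fin n → ℝ) :
    (projL : (Fin n ⊕ Fin n → ℝ) →L[ℝ] (Fin n → ℝ)) x = fun j => x (Sum.inl j) := rfl

/-- **The linearisation IS the Jacobian**: for `D_i ≠ 0` the closed-loop field (error coordinates)
has Fréchet derivative `toLin' (dapiJac θ*)` at every state `(θ*, p̃₀)`.
[cite: SimpsonporcoDorflerBullo2013, App. C («we linearize the DAE … about the regular fixed point»)] -/
theorem hasFDerivAt_dapiField (hD : ∀ i, W.Dc i ≠ 0) (θs q₀ : Fin n → ℝ) :
    HasFDerivAt W.dapiField (LinearMap.toContinuousLinearMap (Matrix.toLin' (W.dapiJac θs)))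
      (phase θs q₀) := by
  set x₀ : Fin n ⊕ Fin n → ℝ := phase θs q₀ with hx₀
  set A : (Fin n → ℝ) →L[ℝ] (Fin n → ℝ) :=
    LinearMap.toContinuousLinearMap (Matrix.toLin' (W.auxJac θs)) with hAdef
  have hproj : ∀ k : Fin n ⊕ Fin n, HasFDerivAt (fun x : Fin n ⊕ Fin n → ℝ => x k)
      (ContinuousLinearMap.proj k : (Fin n ⊕ Fin n → ℝ) →L[ℝ] ℝ) x₀ := fun k => hasFDerivAt_apply k _
  have hθ : (projL : (Fin n ⊕ Fin n → ℝ) →L[ℝ] (Fin n → ℝ)) x₀ = θs := by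
    rw [projL_apply]; funext j; simp [hx₀, phase]
  have hg : HasFDerivAt W.toDroopNetwork.auxField A
      ((projL : (Fin n ⊕ Fin n → ℝ) →L[ℝ] (Fin n → ℝ)) x₀) := by
    rw [hθ]; exact DroopNetwork.hasFDerivAt_auxField (N := W.toDroopNetwork) θs
  have hA : HasFDerivAt (fun x : Fin n ⊕ Fin n → ℝ => W.auxField (fun j => x (Sum.inl j)))
      (A.comp projL) x₀ := by
    have := hg.comp x₀ (projL : (Fin n ⊕ Fin n → ℝ) →L[ℝ] (Fin n → ℝ)).hasFDerivAt
    exact this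
  have hAi : ∀ i, HasFDerivAt (fun x : Fin n ⊕ Fin n → ℝ => W.auxField (fun j => x (Sum.inl j)) i)
      ((ContinuousLinearMap.proj i : (Fin n → ℝ) →L[ℝ] ℝ).comp (A.comp projL)) x₀ :=
    fun i => hasFDerivAt_pi'.1 hA i
  have hAi_apply : ∀ i (h : Fin n ⊕ Fin n → ℝ),
      ((ContinuousLinearMap.proj i : (Fin n → ℝ) →L[ℝ] ℝ).comp (A.comp projL)) h
        = (W.auxJac θs *ᵥ fun j => h (Sum.inl j)) i := by
    intro i h
    simp only [ContinuousLinearMap.comp_apply, projL_apply, hAdef,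
      LinearMap.coe_toContinuousLinearMap', Matrix.toLin'_apply, ContinuousLinearMap.proj_apply]
  rw [hasFDerivAt_pi']
  intro kk
  cases kk with
  | inl i =>
    have hF : HasFDerivAt (fun x : Fin n ⊕ Fin n → ℝ => W.dapiField x (Sum.inl i))
        (((ContinuousLinearMap.proj i : (Fin n → ℝ) →L[ℝ] ℝ).comp (A.comp projL))
          - (W.Dc i)⁻¹ • (ContinuousLinearMap.proj (Sum.inr i) : (Fin n ⊕ Fin n → ℝ) →L[ℝ] ℝ)) x₀ := by
      have h1 := (hAi i).sub ((hproj (Sum.inr i)).const_mul (W.Dc i)⁻¹)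
      refine h1.congr_of_eventuallyEq (Eventually.of_forall fun x => ?_)
      simp only [dapiField, Sum.elim_inl, div_eq_inv_mul, Pi.sub_apply]
    refine hF.congr_fderiv (ContinuousLinearMap.ext fun h => ?_)
    rw [ContinuousLinearMap.comp_apply, LinearMap.coe_toContinuousLinearMap', Matrix.toLin'_apply,
      ContinuousLinearMap.proj_apply, dapiJac_mulVec_inl, sub_apply, hAi_apply]
    simp only [smul_apply, ContinuousLinearMap.proj_apply, smul_eq_mul, div_eq_inv_mul]
  | inr i =>
    -- the `p̃`-row: `(D_i auxField_i(θ) − p̃_i − Σ_j c_ij (p̃_i/D_i − p̃_j/D_j))/k_i`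
    have hterm : ∀ j : Fin n, HasFDerivAt
        (fun x : Fin n ⊕ Fin n → ℝ => W.comm i j * (x (Sum.inr i) / W.Dc i - x (Sum.inr j) / W.Dc j))
        (W.comm i j • ((W.Dc i)⁻¹ • (ContinuousLinearMap.proj (Sum.inr i) : (Fin n ⊕ Fin n → ℝ) →L[ℝ] ℝ)
          - (W.Dc j)⁻¹ • (ContinuousLinearMap.proj (Sum.inr j) : (Fin n ⊕ Fin n → ℝ) →L[ℝ] ℝ))) x₀ :=
      fun j => by
      have h1 := (((hproj (Sum.inr i)).const_mul (W.Dc i)⁻¹).sub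
        ((hproj (Sum.inr j)).const_mul (W.Dc j)⁻¹)).const_mul (W.comm i j)
      refine h1.congr_of_eventuallyEq (Eventually.of_forall fun x => ?_)
      simp only [div_eq_inv_mul, Pi.sub_apply]
    have hsum : HasFDerivAt
        (fun x : Fin n ⊕ Fin n → ℝ => ∑ j, W.comm i j * (x (Sum.inr i) / W.Dc i - x (Sum.inr j) / W.Dc j))
        (∑ j, W.comm i j • ((W.Dc i)⁻¹ • (ContinuousLinearMap.proj (Sum.inr i) : (Fin n ⊕ Fin n → ℝ) →L[ℝ] ℝ)
          - (W.Dc j)⁻¹ • (ContinuousLinearMap.proj (Sum.inr j) : (Fin n ⊕ Fin n → ℝ) →L[ℝ] ℝ))) x₀ :=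
      HasFDerivAt.fun_sum (u := Finset.univ) fun j _ => hterm j
    have hF : HasFDerivAt (fun x : Fin n ⊕ Fin n → ℝ => W.dapiField x (Sum.inr i))
        ((W.kgain i)⁻¹ • ((W.Dc i • ((ContinuousLinearMap.proj i : (Fin n → ℝ) →L[ℝ] ℝ).comp (A.comp projL))
          - (ContinuousLinearMap.proj (Sum.inr i) : (Fin n ⊕ Fin n → ℝ) →L[ℝ] ℝ))
          - ∑ j, W.comm i j • ((W.Dc i)⁻¹ • (ContinuousLinearMap.proj (Sum.inr i) : (Fin n ⊕ Fin n → ℝ) →L[ℝ] ℝ)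
            - (W.Dc j)⁻¹ • (ContinuousLinearMap.proj (Sum.inr j) : (Fin n ⊕ Fin n → ℝ) →L[ℝ] ℝ)))) x₀ := by
      have h1 := ((((hAi i).const_mul (W.Dc i)).sub (hproj (Sum.inr i))).sub hsum).const_mul
        (W.kgain i)⁻¹
      refine h1.congr_of_eventuallyEq (Eventually.of_forall fun x => ?_)
      simp only [dapiField, Sum.elim_inr, div_eq_inv_mul, Pi.sub_apply]
    refine hF.congr_fderiv (ContinuousLinearMap.ext fun h => ?_)
    rw [ContinuousLinearMap.comp_apply, LinearMap.coe_toContinuousLinearMap', Matrix.toLin'_apply,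
      ContinuousLinearMap.proj_apply, dapiJac_mulVec_inr]
    have hrow : W.Dc i * (W.auxJac θs *ᵥ fun j => h (Sum.inl j)) i
        = -(∑ j, W.linWeight θs i j * (h (Sum.inl i) - h (Sum.inl j))) := by
      rw [DroopNetwork.auxJac_mulVec, mul_div_cancel₀ _ (hD i)]
    have hsum_apply : ((∑ j, W.comm i j • ((W.Dc i)⁻¹ • (ContinuousLinearMap.proj (Sum.inr i) : (Fin n ⊕ Fin n → ℝ) →L[ℝ] ℝ)
          - (W.Dc j)⁻¹ • (ContinuousLinearMap.proj (Sum.inr j) : (Fin n ⊕ Fin n → ℝ) →L[ℝ] ℝ)))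
            : (Fin n ⊕ Fin n → ℝ) →L[ℝ] ℝ) h
        = ∑ j, W.comm i j * (h (Sum.inr i) / W.Dc i - h (Sum.inr j) / W.Dc j) := by
      simp only [_root_.sum_apply, smul_apply, sub_apply, ContinuousLinearMap.proj_apply, smul_eq_mul,
        div_eq_inv_mul]
    simp only [smul_apply, sub_apply, ContinuousLinearMap.proj_apply, smul_eq_mul, hAi_apply, hrow,
      hsum_apply]
    ring

/-! ## §2 The spectrum of the Jacobian: left half-plane except the rotation mode -/

/-- The complexified Laplacian row. [folklore] -/
private theorem lap_map_row (θs : Fin n → ℝ) (v : Fin n ⊕ Fin n → ℂ) (i : Fin n) :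
    ∑ j, ((W.lap θs i j : ℝ) : ℂ) * v (Sum.inl j)
      = ∑ j, (W.linWeight θs i j : ℂ) * (v (Sum.inl i) - v (Sum.inl j)) := by
  have hentry : ∀ j, ((W.lap θs i j : ℝ) : ℂ)
      = (if i = j then ∑ k, (W.linWeight θs i k : ℂ) else 0) - (W.linWeight θs i j : ℂ) := by
    intro j
    simp only [DroopNetwork.lap]
    split_ifs <;> push_cast <;> ring
  simp only [hentry, sub_mul, Finset.sum_sub_distrib, ite_mul, zero_mul, Finset.sum_ite_eq,
    Finset.mem_univ, if_true, mul_sub, Finset.sum_mul]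

/-- The complexified communication-Laplacian row. [folklore] -/
private theorem commLap_map_row (y : Fin n → ℂ) (i : Fin n) :
    ∑ j, ((W.commLap i j : ℝ) : ℂ) * y j = ∑ j, (W.comm i j : ℂ) * (y i - y j) := by
  have hentry : ∀ j, ((W.commLap i j : ℝ) : ℂ)
      = (if i = j then ∑ k, (W.comm i k : ℂ) else 0) - (W.comm i j : ℂ) := by
    intro j
    simp only [commLap]
    split_ifs <;> push_cast <;> ring
  simp only [hentry, sub_mul, Finset.sum_sub_distrib, ite_mul, zero_mul, Finset.sum_ite_eq,
    Finset.mem_univ, if_true, mul_sub, Finset.sum_mul]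

/-- `θ`-row of the complexified Jacobian. [cite: SimpsonporcoDorflerBullo2013, App. C] -/
theorem dapiJac_map_mulVec_inl (θs : Fin n → ℝ) (v : Fin n ⊕ Fin n → ℂ) (i : Fin n) :
    (((W.dapiJac θs).map ((↑) : ℝ → ℂ)) *ᵥ v) (Sum.inl i)
      = (-(∑ j, (W.linWeight θs i j : ℂ) * (v (Sum.inl i) - v (Sum.inl j))) - v (Sum.inr i))
          / (W.Dc i : ℂ) := by
  simp only [Matrix.mulVec, dotProduct, Matrix.map_apply, Fintype.sum_sum_type, dapiJac,
    Matrix.fromBlocks_apply₁₁, Matrix.fromBlocks_apply₁₂, Matrix.diagonal_apply, DroopNetwork.auxJac]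
  rw [← lap_map_row]
  have h1 : ∀ j, (((-W.lap θs i j / W.Dc i : ℝ) : ℂ)) * v (Sum.inl j)
      = (((W.lap θs i j : ℝ) : ℂ) * v (Sum.inl j)) * (-((W.Dc i : ℂ))⁻¹) := by
    intro j; push_cast; ring
  have h2 : ∀ j, ((if i = j then -1 / W.Dc i else 0 : ℝ) : ℂ) * v (Sum.inr j)
      = if i = j then -((W.Dc i : ℂ))⁻¹ * v (Sum.inr j) else 0 := by
    intro j; split_ifs <;> push_cast <;> ring
  simp only [h1, h2, ← Finset.sum_mul, Finset.sum_ite_eq, Finset.mem_univ, if_true]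
  ring

/-- `p̃`-row of the complexified Jacobian. [cite: SimpsonporcoDorflerBullo2013, App. C] -/
theorem dapiJac_map_mulVec_inr (θs : Fin n → ℝ) (v : Fin n ⊕ Fin n → ℂ) (i : Fin n) :
    (((W.dapiJac θs).map ((↑) : ℝ → ℂ)) *ᵥ v) (Sum.inr i)
      = (-(∑ j, (W.linWeight θs i j : ℂ) * (v (Sum.inl i) - v (Sum.inl j))) - v (Sum.inr i)
          - ∑ j, (W.comm i j : ℂ) * (v (Sum.inr i) / (W.Dc i : ℂ) - v (Sum.inr j) / (W.Dc j : ℂ)))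
          / (W.kgain i : ℂ) := by
  have hc : ∑ j, ((W.commLap i j : ℝ) : ℂ) * (v (Sum.inr j) / (W.Dc j : ℂ))
      = ∑ j, (W.comm i j : ℂ) * (v (Sum.inr i) / (W.Dc i : ℂ) - v (Sum.inr j) / (W.Dc j : ℂ)) :=
    commLap_map_row (W := W) (fun j => v (Sum.inr j) / (W.Dc j : ℂ)) i
  simp only [Matrix.mulVec, dotProduct, Matrix.map_apply, Fintype.sum_sum_type, dapiJac,
    Matrix.fromBlocks_apply₂₁, Matrix.fromBlocks_apply₂₂]
  have h1 : ∀ j, (((-W.lap θs i j / W.kgain i : ℝ) : ℂ)) * v (Sum.inl j)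
      = (((W.lap θs i j : ℝ) : ℂ) * v (Sum.inl j)) * (-((W.kgain i : ℂ))⁻¹) := by
    intro j; push_cast; ring
  have h2 : ∀ j, ((-((if i = j then (1 : ℝ) else 0) + W.commLap i j / W.Dc j) / W.kgain i : ℝ) : ℂ)
        * v (Sum.inr j)
      = ((if i = j then v (Sum.inr j) else 0)
          + ((W.commLap i j : ℝ) : ℂ) * (v (Sum.inr j) / (W.Dc j : ℂ))) * (-((W.kgain i : ℂ))⁻¹) := by
    intro j; split_ifs <;> push_cast <;> ring
  simp only [h1, h2, ← Finset.sum_mul, Finset.sum_add_distrib, Finset.sum_ite_eq, Finset.mem_univ,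
    if_true]
  rw [lap_map_row, hc]
  ring

/-- The Laplacian form over `ℂ`: `2 Σ_i conj(v_i) Σ_j c_ij (v_i − v_j) = Σ_i Σ_j c_ij |v_i − v_j|²`
(symmetric `c`). [folklore] -/
private theorem conj_lapForm_eq {c : Fin n → Fin n → ℝ} (hc : ∀ i j, c i j = c j i) (v : Fin n → ℂ) :
    2 * ∑ i, conj (v i) * ∑ j, (c i j : ℂ) * (v i - v j)
      = ((∑ i, ∑ j, c i j * ‖v i - v j‖ ^ 2 : ℝ) : ℂ) := by
  have hS : ∑ i, conj (v i) * ∑ j, (c i j : ℂ) * (v i - v j)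
      = ∑ i, ∑ j, (c i j : ℂ) * (conj (v i) * (v i - v j)) := by
    refine Finset.sum_congr rfl fun i _ => ?_
    rw [Finset.mul_sum]
    refine Finset.sum_congr rfl fun j _ => ?_
    ring
  have hS' : ∑ i, ∑ j, (c i j : ℂ) * (conj (v i) * (v i - v j))
      = ∑ i, ∑ j, (c i j : ℂ) * (conj (v j) * (v j - v i)) := by
    rw [Finset.sum_comm]
    refine Finset.sum_congr rfl fun i _ => Finset.sum_congr rfl fun j _ => ?_
    rw [hc j i]
  rw [two_mul, hS]
  conv_lhs => arg 2; rw [hS']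
  push_cast
  rw [← Finset.sum_add_distrib]
  refine Finset.sum_congr rfl fun i _ => ?_
  rw [← Finset.sum_add_distrib]
  refine Finset.sum_congr rfl fun j _ => ?_
  rw [← Complex.conj_mul' (v i - v j), map_sub]
  ring

/-- A complex Laplacian form with a real PSD + kernel certificate is a nonnegative real, and it
vanishes only on constant vectors. [folklore] -/
private theorem lapForm_real_of_psd {c : Fin n → Fin n → ℝ} (hc : ∀ i j, c i j = c j i)
    (hpsd : ∀ u : Fin n → ℝ, 0 ≤ ∑ i, u i * ∑ j, c i j * (u i - u j))
    (hker : ∀ u : Fin n → ℝ, ∑ i, u i * ∑ j, c i j * (u i - u j) = 0 → ∃ a : ℝ, u = fun _ => a)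
    (v : Fin n → ℂ) :
    ∃ r : ℝ, 0 ≤ r ∧ (∑ i, conj (v i) * ∑ j, (c i j : ℂ) * (v i - v j)) = (r : ℂ) ∧
      (r = 0 → ∃ a : ℂ, v = fun _ => a) := by
  obtain ⟨R, hR⟩ : ∃ R : ℂ, R = ∑ i, conj (v i) * ∑ j, (c i j : ℂ) * (v i - v j) := ⟨_, rfl⟩
  obtain ⟨Q, hQ⟩ : ∃ Q : ℝ, Q = ∑ i, ∑ j, c i j * ‖v i - v j‖ ^ 2 := ⟨_, rfl⟩
  obtain ⟨fr, hfr⟩ : ∃ fr : ℝ, fr = ∑ i, (v i).re * ∑ j, c i j * ((v i).re - (v j).re) := ⟨_, rfl⟩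
  obtain ⟨fi, hfi⟩ : ∃ fi : ℝ, fi = ∑ i, (v i).im * ∑ j, c i j * ((v i).im - (v j).im) := ⟨_, rfl⟩
  have hRQ : 2 * R = (Q : ℂ) := by rw [hR, hQ]; exact conj_lapForm_eq hc v
  have hRre : R.re = fr + fi := by rw [hR, hfr, hfi]; exact DroopNetwork.re_conj_lapForm c v
  have hRim : R.im = 0 := by
    have h := congrArg Complex.im hRQ
    simp only [Complex.mul_im, Complex.ofReal_im] at h
    norm_num at h
    exact h
  have hfr0 : 0 ≤ fr := by rw [hfr]; exact hpsd _
  have hfi0 : 0 ≤ fi := by rw [hfi]; exact hpsd _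
  refine ⟨fr + fi, by positivity, ?_, fun h0 => ?_⟩
  · rw [← hR]
    exact Complex.ext (by simp [hRre]) (by simp [hRim])
  · have hfr00 : fr = 0 := by linarith
    have hfi00 : fi = 0 := by linarith
    obtain ⟨ar, har⟩ := hker _ (hfr ▸ hfr00)
    obtain ⟨ai, hai⟩ := hker _ (hfi ▸ hfi00)
    refine ⟨⟨ar, ai⟩, funext fun i => Complex.ext ?_ ?_⟩
    · simpa using congrFun har i
    · simpa using congrFun hai i

/-- `Σ_i Σ_j c_ij (v_i − v_j) = 0` for symmetric `c` (zero column sums of a Laplacian). [folklore] -/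
private theorem sum_lapRow_eq_zero {c : Fin n → Fin n → ℝ} (hc : ∀ i j, c i j = c j i)
    (v : Fin n → ℂ) : ∑ i, ∑ j, (c i j : ℂ) * (v i - v j) = 0 := by
  have hswap : ∑ i, ∑ j, (c i j : ℂ) * (v i - v j) = ∑ i, ∑ j, (c j i : ℂ) * (v j - v i) :=
    Finset.sum_comm
  have hneg : ∑ i, ∑ j, (c j i : ℂ) * (v j - v i) = -∑ i, ∑ j, (c i j : ℂ) * (v i - v j) := by
    rw [← Finset.sum_neg_distrib]
    refine Finset.sum_congr rfl fun i _ => ?_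
    rw [← Finset.sum_neg_distrib]
    refine Finset.sum_congr rfl fun j _ => ?_
    rw [hc j i]; ring
  have h2 : (2 : ℂ) * ∑ i, ∑ j, (c i j : ℂ) * (v i - v j) = 0 := by
    linear_combination hswap + hneg
  exact (mul_eq_zero.1 h2).resolve_left two_ne_zero

/-- `conj a (a/D + b) + conj b (a + D b) = |a + D b|²/D` for real `D ≠ 0`. [folklore] -/
private theorem pair_form_eq {D : ℝ} (hD : D ≠ 0) (a b : ℂ) :
    conj a * (a / (D : ℂ) + b) + conj b * (a + (D : ℂ) * b)
      = ((‖a + (D : ℂ) * b‖ ^ 2 / D : ℝ) : ℂ) := by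
  have hDC : (D : ℂ) ≠ 0 := by exact_mod_cast hD
  have key : ((‖a + (D : ℂ) * b‖ : ℂ) ^ 2) = conj (a + (D : ℂ) * b) * (a + (D : ℂ) * b) := by
    rw [Complex.conj_mul']
  push_cast
  rw [key, map_add, map_mul, Complex.conj_ofReal]
  field_simp

/-- **The spectral lemma of the DAPI closed loop, PROVED** (replacing the printed continuity
argument by the Hermitian identity `⟨X₂v, X₁X₂v⟩ = −μ⟨X₂v, Zv⟩`): `D_i > 0`, `k_i > 0`, `|Y|`
symmetric, symmetric communication weights, and real PSD + kernel certificates for BOTH Laplacian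
forms — the linearised network `u ↦ Σ_i u_i Σ_j a_ij cos(θ*_i − θ*_j)(u_i − u_j)` and the
communication graph `u ↦ Σ_i u_i Σ_j c_ij(u_i − u_j)` are `≥ 0` with kernel the constants.  Then every
complex eigenpair `(μ, v)` of `dapiJac θ*` has `Re μ < 0`, or `μ = 0` with `v` a complex multiple of
the rotation mode `(𝟙, 0)` («all eigenvalues are real and negative … modulo rotational symmetry»).
[cite: SimpsonporcoDorflerBullo2013, App. C (proof of Theorem 8: `X₁ ⪰ 0` with kernel
`(−D𝟙, 𝟙)`, `X₂ ⪰ 0` with kernel `(𝟙, 0)`, `image X₂ ∩ ker X₁ = 0`)] -/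
theorem dapiJac_eig_re_neg_or_rotation (hD : ∀ i, 0 < W.Dc i) (hk : ∀ i, 0 < W.kgain i)
    (hY : ∀ i j, W.Yabs i j = W.Yabs j i) (hcs : ∀ i j, W.comm i j = W.comm j i) {θs : Fin n → ℝ}
    (hpsd : ∀ u : Fin n → ℝ, 0 ≤ ∑ i, u i * ∑ j, W.linWeight θs i j * (u i - u j))
    (hker : ∀ u : Fin n → ℝ, ∑ i, u i * ∑ j, W.linWeight θs i j * (u i - u j) = 0 →
      ∃ a : ℝ, u = fun _ => a)
    (hcpsd : ∀ u : Fin n → ℝ, 0 ≤ ∑ i, u i * ∑ j, W.comm i j * (u i - u j))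
    (hcker : ∀ u : Fin n → ℝ, ∑ i, u i * ∑ j, W.comm i j * (u i - u j) = 0 →
      ∃ a : ℝ, u = fun _ => a)
    {μ : ℂ} {v : Fin n ⊕ Fin n → ℂ} (hv : v ≠ 0)
    (hJ : (W.dapiJac θs).map ((↑) : ℝ → ℂ) *ᵥ v = μ • v) :
    μ.re < 0 ∨ (μ = 0 ∧ ∃ a : ℂ, v = fun kk => a * (rot kk : ℂ)) := by
  have hℓs : ∀ i j, W.linWeight θs i j = W.linWeight θs j i :=
    DroopNetwork.linWeight_symm (N := W.toDroopNetwork) hY θs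
  -- components and the vector `w = X₂ v = (L v₁, D⁻¹ v₂)`
  set v₁ : Fin n → ℂ := fun i => v (Sum.inl i) with hv₁
  set v₂ : Fin n → ℂ := fun i => v (Sum.inr i) with hv₂
  set w₁ : Fin n → ℂ := fun i => ∑ j, (W.linWeight θs i j : ℂ) * (v₁ i - v₁ j) with hw₁
  set w₂ : Fin n → ℂ := fun i => v₂ i / (W.Dc i : ℂ) with hw₂
  have hDC : ∀ i, (W.Dc i : ℂ) ≠ 0 := fun i => by exact_mod_cast (hD i).ne'
  have hkC : ∀ i, (W.kgain i : ℂ) ≠ 0 := fun i => by exact_mod_cast (hk i).ne'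
  have hv₂w : ∀ i, v₂ i = (W.Dc i : ℂ) * w₂ i := fun i => by
    simp only [hw₂]; field_simp [hDC i]
  -- the two block rows of the eigen-equation
  have hE1 : ∀ i, w₁ i / (W.Dc i : ℂ) + w₂ i = -μ * v₁ i := by
    intro i
    have h1 := congrFun hJ (Sum.inl i)
    rw [dapiJac_map_mulVec_inl] at h1
    simp only [Pi.smul_apply, smul_eq_mul] at h1
    rw [div_eq_iff (hDC i)] at h1
    simp only [hw₁, hw₂, hv₁, hv₂]
    rw [← add_div, div_eq_iff (hDC i)]
    linear_combination -h1
  have hE2 : ∀ i, w₁ i + (W.Dc i : ℂ) * w₂ i + ∑ j, (W.comm i j : ℂ) * (w₂ i - w₂ j)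
      = -μ * (W.kgain i : ℂ) * ((W.Dc i : ℂ) * w₂ i) := by
    intro i
    have h2 := congrFun hJ (Sum.inr i)
    rw [dapiJac_map_mulVec_inr] at h2
    simp only [Pi.smul_apply, smul_eq_mul] at h2
    rw [div_eq_iff (hkC i)] at h2
    rw [← hv₂w i]
    have hsum : ∑ j, (W.comm i j : ℂ) * (w₂ i - w₂ j)
        = ∑ j, (W.comm i j : ℂ) * (v (Sum.inr i) / (W.Dc i : ℂ) - v (Sum.inr j) / (W.Dc j : ℂ)) := by
      simp only [hw₂, hv₂]
    rw [hsum]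
    simp only [hw₁, hv₁, hv₂]
    linear_combination -h2
  -- the three Hermitian forms
  obtain ⟨rl, hrl0, hRl, hrl_ker⟩ := lapForm_real_of_psd hℓs hpsd hker v₁
  obtain ⟨rc, hrc0, hRc, hrc_ker⟩ := lapForm_real_of_psd hcs hcpsd hcker w₂
  obtain ⟨P, hP⟩ : ∃ P : ℝ, P = ∑ i, ‖w₁ i + (W.Dc i : ℂ) * w₂ i‖ ^ 2 / W.Dc i := ⟨_, rfl⟩
  obtain ⟨Nw, hNw⟩ : ∃ Nw : ℝ, Nw = ∑ i, W.kgain i * W.Dc i * ‖w₂ i‖ ^ 2 := ⟨_, rfl⟩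
  have hP0 : 0 ≤ P := by
    rw [hP]; exact Finset.sum_nonneg fun i _ => div_nonneg (sq_nonneg _) (hD i).le
  have hNw0 : 0 ≤ Nw := by
    rw [hNw]; exact Finset.sum_nonneg fun i _ => by
      have := hk i; have := hD i; positivity
  -- `Σ conj(w₁)(E1) + Σ conj(w₂)(E2)`: the left side is `P + rc`, the right side `−μ (rl + Nw)`
  have hleft : ∑ i, (conj (w₁ i) * (w₁ i / (W.Dc i : ℂ) + w₂ i)
      + conj (w₂ i) * (w₁ i + (W.Dc i : ℂ) * w₂ i + ∑ j, (W.comm i j : ℂ) * (w₂ i - w₂ j)))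
      = (P : ℂ) + (rc : ℂ) := by
    have hsplit : ∀ i, conj (w₁ i) * (w₁ i / (W.Dc i : ℂ) + w₂ i)
        + conj (w₂ i) * (w₁ i + (W.Dc i : ℂ) * w₂ i + ∑ j, (W.comm i j : ℂ) * (w₂ i - w₂ j))
        = ((‖w₁ i + (W.Dc i : ℂ) * w₂ i‖ ^ 2 / W.Dc i : ℝ) : ℂ)
          + conj (w₂ i) * ∑ j, (W.comm i j : ℂ) * (w₂ i - w₂ j) := by
      intro i
      rw [← pair_form_eq (hD i).ne']
      ring
    simp only [hsplit, Finset.sum_add_distrib, hRc, hP]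
    push_cast
    rfl
  have hw₁v₁ : ∑ i, conj (w₁ i) * v₁ i = (rl : ℂ) := by
    have h1 : ∑ i, conj (w₁ i) * v₁ i = conj (∑ i, conj (v₁ i) * w₁ i) := by
      rw [map_sum]
      refine Finset.sum_congr rfl fun i _ => ?_
      rw [map_mul, Complex.conj_conj, mul_comm]
    rw [h1, hRl, Complex.conj_ofReal]
  have hright : ∑ i, (conj (w₁ i) * (-μ * v₁ i)
      + conj (w₂ i) * (-μ * (W.kgain i : ℂ) * ((W.Dc i : ℂ) * w₂ i)))
      = -μ * ((rl : ℂ) + (Nw : ℂ)) := by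
    have h1 : ∑ i, (conj (w₁ i) * (-μ * v₁ i)
        + conj (w₂ i) * (-μ * (W.kgain i : ℂ) * ((W.Dc i : ℂ) * w₂ i)))
        = -μ * (∑ i, conj (w₁ i) * v₁ i) + -μ * ∑ i, (W.kgain i : ℂ) * (W.Dc i : ℂ) * (conj (w₂ i) * w₂ i) := by
      rw [Finset.mul_sum, Finset.mul_sum, ← Finset.sum_add_distrib]
      refine Finset.sum_congr rfl fun i _ => ?_
      ring
    rw [h1, hw₁v₁, hNw]
    push_cast
    have h2 : ∑ i, (W.kgain i : ℂ) * (W.Dc i : ℂ) * (conj (w₂ i) * w₂ i)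
        = ∑ i, (W.kgain i : ℂ) * (W.Dc i : ℂ) * ((‖w₂ i‖ : ℂ) ^ 2) := by
      refine Finset.sum_congr rfl fun i _ => ?_
      rw [Complex.conj_mul']
    rw [h2]
    ring
  have hkey : (P : ℂ) + (rc : ℂ) = -μ * ((rl : ℂ) + (Nw : ℂ)) := by
    rw [← hleft, ← hright]
    refine Finset.sum_congr rfl fun i _ => ?_
    rw [hE1 i, hE2 i]
  -- case analysis on `N = rl + Nw`
  rcases (add_nonneg hrl0 hNw0).lt_or_eq with hNpos | hN0
  · -- `N > 0`: `μ = −(P + rc)/N` is real and `≤ 0`; it is `< 0` unless `P = rc = 0`, impossible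
    left
    have hμ : μ = (( -(P + rc) / (rl + Nw) : ℝ) : ℂ) := by
      have hNC : ((rl + Nw : ℝ) : ℂ) ≠ 0 := by exact_mod_cast hNpos.ne'
      push_cast at hNC ⊢
      field_simp
      linear_combination hkey
    rw [hμ, Complex.ofReal_re]
    apply div_neg_of_neg_of_pos _ hNpos
    rcases (add_nonneg hP0 hrc0).lt_or_eq with hpos | hzero
    · linarith
    · exfalso
      have hP00 : P = 0 := by linarith
      have hrc00 : rc = 0 := by linarith
      -- `P = 0`: every `w₁ i + D_i w₂ i = 0`
      have hpair : ∀ i, w₁ i + (W.Dc i : ℂ) * w₂ i = 0 := by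
        intro i
        have hterm : ∀ j ∈ (Finset.univ : Finset (Fin n)),
            0 ≤ ‖w₁ j + (W.Dc j : ℂ) * w₂ j‖ ^ 2 / W.Dc j :=
          fun j _ => div_nonneg (sq_nonneg _) (hD j).le
        have h0 := (Finset.sum_eq_zero_iff_of_nonneg hterm).1 (hP ▸ hP00) i (Finset.mem_univ i)
        rcases div_eq_zero_iff.1 h0 with h | h
        · exact norm_eq_zero.1 (pow_eq_zero_iff (n := 2) (by norm_num) |>.1 h)
        · exact absurd h (hD i).ne'
      -- `rc = 0`: `w₂` is constant, `w₂ = b𝟙`; then `w₁ = −bD𝟙`, and summing `w₁` gives `b = 0`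
      obtain ⟨b, hb⟩ := hrc_ker hrc00
      have hw₁b : ∀ i, w₁ i = -(b * (W.Dc i : ℂ)) := fun i => by
        have := hpair i
        rw [hb] at this
        linear_combination this
      have hsumw₁ : ∑ i, w₁ i = 0 := by
        simp only [hw₁]
        exact sum_lapRow_eq_zero hℓs v₁
      have hDs : 0 < ∑ i, W.Dc i := by
        obtain ⟨kk, hkk⟩ : ∃ kk, v kk ≠ 0 := by
          by_contra hcon; push Not at hcon; exact hv (funext hcon)
        have hne : Nonempty (Fin n) := by
          cases kk with
          | inl i => exact ⟨i⟩
          | inr i => exact ⟨i⟩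
        exact Finset.sum_pos (fun i _ => hD i) Finset.univ_nonempty
      have hb0 : b = 0 := by
        have h1 : ∑ i, w₁ i = -(b * ((∑ i, W.Dc i : ℝ) : ℂ)) := by
          push_cast
          rw [Finset.mul_sum, ← Finset.sum_neg_distrib]
          exact Finset.sum_congr rfl fun i _ => hw₁b i
        rw [hsumw₁] at h1
        have hDsC : ((∑ i, W.Dc i : ℝ) : ℂ) ≠ 0 := by exact_mod_cast hDs.ne'
        have : b * ((∑ i, W.Dc i : ℝ) : ℂ) = 0 := by linear_combination h1
        exact (mul_eq_zero.1 this).resolve_right hDsC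
      have hw₂0 : ∀ i, w₂ i = 0 := fun i => by rw [hb, hb0]
      have hw₁0 : ∀ i, w₁ i = 0 := fun i => by rw [hw₁b i, hb0]; ring
      -- then `Nw = 0` and `rl = Σ conj(v₁) w₁ = 0`: contradiction with `N > 0`
      have hNw00 : Nw = 0 := by
        rw [hNw]
        exact Finset.sum_eq_zero fun i _ => by rw [hw₂0 i]; simp
      have hrl00 : rl = 0 := by
        have h1 : (rl : ℂ) = 0 := by
          rw [← hRl]
          exact Finset.sum_eq_zero fun i _ => by
            have := hw₁0 i
            simp only [hw₁] at this
            rw [this, mul_zero]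
        exact_mod_cast h1
      linarith
  · -- `N = 0`: `w₂ = 0` (so `v₂ = 0`) and `rl = 0` (so `v₁` is constant): the rotation mode
    right
    have hrl00 : rl = 0 := by linarith
    have hNw00 : Nw = 0 := by linarith
    have hw₂0 : ∀ i, w₂ i = 0 := by
      intro i
      have hterm : ∀ j ∈ (Finset.univ : Finset (Fin n)), 0 ≤ W.kgain j * W.Dc j * ‖w₂ j‖ ^ 2 :=
        fun j _ => by have := hk j; have := hD j; positivity
      have h0 := (Finset.sum_eq_zero_iff_of_nonneg hterm).1 (hNw ▸ hNw00) i (Finset.mem_univ i)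
      have hkD : W.kgain i * W.Dc i ≠ 0 := (mul_pos (hk i) (hD i)).ne'
      rcases mul_eq_zero.1 h0 with h | h
      · exact absurd h hkD
      · exact norm_eq_zero.1 (pow_eq_zero_iff (n := 2) (by norm_num) |>.1 h)
    have hv₂0 : ∀ i, v₂ i = 0 := fun i => by rw [hv₂w i, hw₂0 i, mul_zero]
    obtain ⟨a, ha⟩ := hrl_ker hrl00
    have hw₁0 : ∀ i, w₁ i = 0 := fun i => by
      simp only [hw₁, ha, sub_self, mul_zero, Finset.sum_const_zero]
    -- `μ = 0`: pick a coordinate where `v ≠ 0`; it is an angle coordinate, `v₁ i = a ≠ 0`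
    have ha0 : a ≠ 0 := by
      intro ha0
      apply hv
      funext kk
      cases kk with
      | inl i => have := congrFun ha i; simp only [hv₁] at this; rw [this, ha0]; rfl
      | inr i => exact hv₂0 i
    obtain ⟨i₀⟩ : Nonempty (Fin n) := by
      obtain ⟨kk, -⟩ : ∃ kk, v kk ≠ 0 := by
        by_contra hcon; push Not at hcon; exact hv (funext hcon)
      cases kk with
      | inl i => exact ⟨i⟩
      | inr i => exact ⟨i⟩
    have hμ0 : μ = 0 := by
      have h1 := hE1 i₀
      rw [hw₁0 i₀, hw₂0 i₀, zero_div, add_zero] at h1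
      have hva : v₁ i₀ = a := congrFun ha i₀
      rw [hva] at h1
      have : μ * a = 0 := by linear_combination h1
      exact (mul_eq_zero.1 this).resolve_right ha0
    refine ⟨hμ0, a, funext fun kk => ?_⟩
    cases kk with
    | inl i => have := congrFun ha i; simpa [rot, hv₁] using this
    | inr i => have := hv₂0 i; simpa [rot, hv₂] using this

/-! ## §3 Theorem 8 (ii), stability clause: local exponential stability of `(θ*, p* = Dω_avg)`
modulo the rotation -/

/-- The arc / connectivity hypotheses of the paper are certificates: `c ≥ 0` symmetric with a
connected graph ⇒ the real Laplacian form of `c` is `≥ 0` with kernel the constants.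
[cite: SimpsonporcoDorflerBullo2013, §5 («weighted, undirected and connected communication graph»)] -/
theorem commForm_certificate_of_connected {c : Fin n → Fin n → ℝ} (hcs : ∀ i j, c i j = c j i)
    (hc0 : ∀ i j, 0 ≤ c i j) (hconn : ClassicalModel.CouplingConnected c) :
    (∀ u : Fin n → ℝ, 0 ≤ ∑ i, u i * ∑ j, c i j * (u i - u j)) ∧
    (∀ u : Fin n → ℝ, ∑ i, u i * ∑ j, c i j * (u i - u j) = 0 → ∃ a : ℝ, u = fun _ => a) := by
  have hterm : ∀ u : Fin n → ℝ, ∀ i j, 0 ≤ c i j * (u i - u j) ^ 2 :=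
    fun u i j => mul_nonneg (hc0 i j) (sq_nonneg _)
  refine ⟨fun u => ?_, fun u hu => ?_⟩
  · rw [DroopNetwork.lapForm_eq_half_sum hcs]
    exact mul_nonneg (by norm_num) (Finset.sum_nonneg fun i _ => Finset.sum_nonneg fun j _ =>
      hterm u i j)
  · rw [DroopNetwork.lapForm_eq_half_sum hcs] at hu
    have hsum : ∑ i, ∑ j, c i j * (u i - u j) ^ 2 = 0 := by linarith
    have hij0 : ∀ i j, c i j * (u i - u j) ^ 2 = 0 := by
      intro i j
      have hrow := (Finset.sum_eq_zero_iff_of_nonneg fun i _ =>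
        Finset.sum_nonneg fun j _ => hterm u i j).1 hsum i (Finset.mem_univ i)
      exact (Finset.sum_eq_zero_iff_of_nonneg fun j _ => hterm u i j).1 hrow j (Finset.mem_univ j)
    have hlines : ∀ i j, i ≠ j → 0 < c i j → u i - u j = (0 : Fin n → ℝ) i - (0 : Fin n → ℝ) j := by
      intro i j _ hpos
      have h0 : (u i - u j) ^ 2 = 0 := by
        rcases mul_eq_zero.1 (hij0 i j) with h | h
        · exact absurd h hpos.ne'
        · exact h
      simpa using pow_eq_zero_iff (n := 2) (by norm_num) |>.1 h0
    obtain ⟨a, hau⟩ := ClassicalModel.exists_const_of_lineAngles_eq hconn hlines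
    exact ⟨a, funext fun i => by simpa using hau i⟩

/-- **LES within a leaf of the conserved quantity `Σ D_iθ_i − Σ k_ip̃_i`** (state-space form, error
coordinates): `D_i > 0`, `k_i > 0`, symmetric `|Y|` and `c`, an (Aux)-equilibrium `θ*` (the angle
array of Theorem 2's synchronized solution) with the PSD + kernel certificates for `L(θ*)` and
`L_c`.  [cite: SimpsonporcoDorflerBullo2013, Theorem 8 (ii) and App. C] -/
theorem expStable_within_leaf (hD : ∀ i, 0 < W.Dc i) (hk : ∀ i, 0 < W.kgain i)
    (hY : ∀ i j, W.Yabs i j = W.Yabs j i) (hcs : ∀ i j, W.comm i j = W.comm j i) {θs : Fin n → ℝ}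
    (hθs : W.IsAuxEquilibrium θs)
    (hpsd : ∀ u : Fin n → ℝ, 0 ≤ ∑ i, u i * ∑ j, W.linWeight θs i j * (u i - u j))
    (hker : ∀ u : Fin n → ℝ, ∑ i, u i * ∑ j, W.linWeight θs i j * (u i - u j) = 0 →
      ∃ a : ℝ, u = fun _ => a)
    (hcpsd : ∀ u : Fin n → ℝ, 0 ≤ ∑ i, u i * ∑ j, W.comm i j * (u i - u j))
    (hcker : ∀ u : Fin n → ℝ, ∑ i, u i * ∑ j, W.comm i j * (u i - u j) = 0 →
      ∃ a : ℝ, u = fun _ => a) :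
    ∃ ρ > 0, ∃ k > 0, ∃ lam > 0, ∀ (X : ℝ → Fin n ⊕ Fin n → ℝ) (T : ℝ),
      (∀ t ∈ Icc 0 T, HasDerivWithinAt X (W.dapiField (X t)) (Icc 0 T) t) →
      W.weights ⬝ᵥ X 0 = W.weights ⬝ᵥ phase θs (fun _ => 0) →
      ‖X 0 - phase θs (fun _ => 0)‖ < ρ →
      ∀ t ∈ Icc 0 T, ‖X t - phase θs (fun _ => 0)‖
        ≤ k * ‖X 0 - phase θs (fun _ => 0)‖ * Real.exp (-lam * t) := by
  rcases isEmpty_or_nonempty (Fin n) with hn | hn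
  · refine ⟨1, one_pos, 1, one_pos, 1, one_pos, fun X T _ _ _ t _ => ?_⟩
    have : X t - phase θs (fun _ => 0) = 0 := funext fun kk => by
      cases kk with
      | inl i => exact (IsEmpty.false i).elim
      | inr i => exact (IsEmpty.false i).elim
    rw [this, norm_zero]
    positivity
  have hD0 : ∀ i, W.Dc i ≠ 0 := fun i => (hD i).ne'
  have hDs : 0 < ∑ i, W.Dc i := Finset.sum_pos (fun i _ => hD i) Finset.univ_nonempty
  have hlr : W.weights ⬝ᵥ rot ≠ 0 := by rw [weights_dotProduct_rot]; exact hDs.ne'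
  exact Literature.Analysis.ODE.exists_expStable_within_of_eig_re_neg_or_smul
    (hasFDerivAt_dapiField hD0 θs fun _ => 0) (dapiField_equilibrium hθs)
    (fun x => weights_dotProduct_dapiField hD0 (fun i => (hk i).ne') hcs x) hlr
    (fun μ v hv hJ => dapiJac_eig_re_neg_or_rotation hD hk hY hcs hpsd hker hcpsd hcker hv hJ)

/-- `|Σ(D, −k)·h| ≤ (Σ D_i + Σ k_i)‖h‖` (sup norm). [folklore] -/
private theorem abs_weights_dotProduct_le (hD : ∀ i, 0 ≤ W.Dc i) (hk : ∀ i, 0 ≤ W.kgain i)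
    (h : Fin n ⊕ Fin n → ℝ) :
    |W.weights ⬝ᵥ h| ≤ (∑ i, W.Dc i + ∑ i, W.kgain i) * ‖h‖ := by
  have hw : ∀ kk, |W.weights kk| * ‖h‖ ≥ |W.weights kk * h kk| := fun kk => by
    rw [abs_mul]
    exact mul_le_mul_of_nonneg_left (by simpa using norm_le_pi_norm h kk) (abs_nonneg _)
  have habs : ∑ kk, |W.weights kk| = ∑ i, W.Dc i + ∑ i, W.kgain i := by
    simp only [Fintype.sum_sum_type, weights, Sum.elim_inl, Sum.elim_inr, abs_neg]
    congr 1
    · exact Finset.sum_congr rfl fun i _ => abs_of_nonneg (hD i)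
    · exact Finset.sum_congr rfl fun i _ => abs_of_nonneg (hk i)
  calc |W.weights ⬝ᵥ h| = |∑ kk, W.weights kk * h kk| := rfl
    _ ≤ ∑ kk, |W.weights kk * h kk| := Finset.abs_sum_le_sum_abs _ _
    _ ≤ ∑ kk, |W.weights kk| * ‖h‖ := Finset.sum_le_sum fun kk _ => hw kk
    _ = (∑ i, W.Dc i + ∑ i, W.kgain i) * ‖h‖ := by rw [← Finset.sum_mul, habs]

/-- **From the leaf to every nearby state** (the conserved quantity picks the rotation): with the
within-leaf estimate as hypothesis `H`, every solution of `X' = dapiField X` on `[0, T]` with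
`‖X(0) − (θ*, 0)‖ < ρ/(1 + K)`, `K = (Σ D_i + Σ k_i)/Σ D_i`, satisfies
`‖X(t) − (θ* + c𝟙, 0)‖ ≤ k‖X(0) − (θ* + c𝟙, 0)‖e^{−λt}`, `c = (D, −k)·(X(0) − (θ*, 0))/Σ D_i`.
[cite: SimpsonporcoDorflerBullo2013, App. C («modulo rotational symmetry»)] -/
theorem expStable_modRotation_of_within_leaf (hD : ∀ i, 0 < W.Dc i) (hk : ∀ i, 0 < W.kgain i)
    {θs : Fin n → ℝ} {ρ k lam : ℝ}
    (H : ∀ (X : ℝ → Fin n ⊕ Fin n → ℝ) (T : ℝ),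
      (∀ t ∈ Icc 0 T, HasDerivWithinAt X (W.dapiField (X t)) (Icc 0 T) t) →
      W.weights ⬝ᵥ X 0 = W.weights ⬝ᵥ phase θs (fun _ => 0) →
      ‖X 0 - phase θs (fun _ => 0)‖ < ρ →
      ∀ t ∈ Icc 0 T, ‖X t - phase θs (fun _ => 0)‖
        ≤ k * ‖X 0 - phase θs (fun _ => 0)‖ * Real.exp (-lam * t)) :
    ∀ (X : ℝ → Fin n ⊕ Fin n → ℝ) (T : ℝ),
      (∀ t ∈ Icc 0 T, HasDerivWithinAt X (W.dapiField (X t)) (Icc 0 T) t) →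
      ‖X 0 - phase θs (fun _ => 0)‖ < ρ / (1 + (∑ i, W.Dc i + ∑ i, W.kgain i) / ∑ i, W.Dc i) →
      ∀ t ∈ Icc 0 T,
        ‖X t - fun kk => phase θs (fun _ => 0) kk
            + W.weights ⬝ᵥ (X 0 - phase θs (fun _ => 0)) / (∑ i, W.Dc i) * rot kk‖
          ≤ k * ‖X 0 - fun kk => phase θs (fun _ => 0) kk
              + W.weights ⬝ᵥ (X 0 - phase θs (fun _ => 0)) / (∑ i, W.Dc i) * rot kk‖
            * Real.exp (-lam * t) := by
  intro X T hX h0 t ht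
  rcases isEmpty_or_nonempty (Fin n) with hn | hn
  · have hz : ∀ s, (X s - fun kk => phase θs (fun _ => 0) kk
        + W.weights ⬝ᵥ (X 0 - phase θs (fun _ => 0)) / (∑ i, W.Dc i) * rot kk) = 0 :=
      fun s => funext fun kk => by
        cases kk with
        | inl i => exact (IsEmpty.false i).elim
        | inr i => exact (IsEmpty.false i).elim
    have hz' : ∀ s, X s - phase θs (fun _ => 0) = 0 := fun s => funext fun kk => by
      cases kk with
      | inl i => exact (IsEmpty.false i).elim
      | inr i => exact (IsEmpty.false i).elim
    have hleaf : W.weights ⬝ᵥ X 0 = W.weights ⬝ᵥ phase θs (fun _ => 0) := by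
      simp [dotProduct]
    have hρ : ‖X 0 - phase θs (fun _ => 0)‖ < ρ := by
      have hw0 : (∑ i, W.Dc i + ∑ i, W.kgain i) / ∑ i, W.Dc i = 0 := by simp
      rw [hw0, add_zero, div_one] at h0
      exact h0
    have key := H X T hX hleaf hρ t ht
    rw [hz' t, hz' 0] at key
    rw [hz t, hz 0]
    exact key
  have hDs : 0 < ∑ i, W.Dc i := Finset.sum_pos (fun i _ => hD i) Finset.univ_nonempty
  obtain ⟨K, hKdef⟩ : ∃ K : ℝ, K = (∑ i, W.Dc i + ∑ i, W.kgain i) / ∑ i, W.Dc i := ⟨_, rfl⟩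
  have hK0 : 0 ≤ K := hKdef ▸ div_nonneg
    (add_nonneg hDs.le (Finset.sum_nonneg fun i _ => (hk i).le)) hDs.le
  rw [← hKdef] at h0
  set x₀ : Fin n ⊕ Fin n → ℝ := phase θs (fun _ => 0) with hx₀
  set c : ℝ := W.weights ⬝ᵥ (X 0 - x₀) / ∑ i, W.Dc i with hcdef
  set Y : ℝ → Fin n ⊕ Fin n → ℝ := fun s kk => X s kk - c * rot kk with hYdef
  have hYsol : ∀ s ∈ Icc 0 T, HasDerivWithinAt Y (W.dapiField (Y s)) (Icc 0 T) s := by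
    intro s hs
    have h1 : HasDerivWithinAt Y (W.dapiField (X s) - 0) (Icc 0 T) s :=
      (hX s hs).sub (hasDerivWithinAt_const s (Icc 0 T) (fun kk : Fin n ⊕ Fin n => c * rot kk))
    have h2 : W.dapiField (Y s) = W.dapiField (X s) := by
      have := dapiField_add_rot (W := W) (X s) (-c)
      simpa [hYdef, sub_eq_add_neg, neg_mul] using this
    rw [h2, ← sub_zero (W.dapiField (X s))]
    exact h1
  have hYleaf : W.weights ⬝ᵥ Y 0 = W.weights ⬝ᵥ x₀ := by
    have h1 : W.weights ⬝ᵥ Y 0 = W.weights ⬝ᵥ X 0 - c * (W.weights ⬝ᵥ rot) := by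
      simp only [hYdef, dotProduct, mul_sub, Finset.sum_sub_distrib, Finset.mul_sum]
      congr 1
      refine Finset.sum_congr rfl fun kk _ => ?_
      ring
    have h2 : c * (W.weights ⬝ᵥ rot) = W.weights ⬝ᵥ X 0 - W.weights ⬝ᵥ x₀ := by
      rw [weights_dotProduct_rot, hcdef, div_mul_cancel₀ _ hDs.ne', dotProduct_sub]
    rw [h1, h2]
    ring
  have hY0 : ‖Y 0 - x₀‖ < ρ := by
    have hc : |c| ≤ K * ‖X 0 - x₀‖ := by
      rw [hcdef, abs_div, abs_of_pos hDs, div_le_iff₀ hDs, hKdef]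
      calc |W.weights ⬝ᵥ (X 0 - x₀)| ≤ (∑ i, W.Dc i + ∑ i, W.kgain i) * ‖X 0 - x₀‖ :=
            abs_weights_dotProduct_le (fun i => (hD i).le) (fun i => (hk i).le) _
        _ = (∑ i, W.Dc i + ∑ i, W.kgain i) / (∑ i, W.Dc i) * ‖X 0 - x₀‖ * ∑ i, W.Dc i := by
            field_simp
    have hdecomp : Y 0 - x₀ = (X 0 - x₀) - fun kk => c * rot kk := by
      funext kk; simp [hYdef]; ring
    have hrot : ‖fun kk : Fin n ⊕ Fin n => c * rot kk‖ ≤ |c| := by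
      refine (pi_norm_le_iff_of_nonneg (abs_nonneg c)).2 fun kk => ?_
      cases kk with
      | inl i => simp [rot]
      | inr i => simp [rot]
    have hX0 : (1 + K) * ‖X 0 - x₀‖ < ρ := by
      have := h0
      rw [lt_div_iff₀ (by positivity)] at this
      linarith
    calc ‖Y 0 - x₀‖ = ‖(X 0 - x₀) - fun kk => c * rot kk‖ := by rw [hdecomp]
      _ ≤ ‖X 0 - x₀‖ + ‖fun kk : Fin n ⊕ Fin n => c * rot kk‖ := norm_sub_le _ _
      _ ≤ ‖X 0 - x₀‖ + K * ‖X 0 - x₀‖ := by linarith [hrot, hc]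
      _ = (1 + K) * ‖X 0 - x₀‖ := by ring
      _ < ρ := hX0
  have key := H Y T hYsol hYleaf hY0 t ht
  have hshape : ∀ s, Y s - x₀ = X s - fun kk => x₀ kk + c * rot kk := fun s => by
    funext kk; simp [hYdef]; ring
  rw [hshape t, hshape 0] at key
  exact key

/-- **A solution of the DAPI closed loop, in the error coordinates `(θ, p − Dω_avg)`, solves
`X' = dapiField X`** (`D_i ≠ 0`). [cite: SimpsonporcoDorflerBullo2013, App. C («error coordinates
`p̃_i(t) = p_i(t) − D_iω_avg`»)] -/
theorem hasDerivAt_phase_of_isSolutionAt (hD : ∀ i, W.Dc i ≠ 0) {θ p : ℝ → Fin n → ℝ}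
    (hsol : ∀ t, W.IsSolutionAt θ p t) (s : ℝ) :
    HasDerivAt (fun s => phase (θ s) (fun i => p s i - W.Dc i * W.avgFrequency))
      (W.dapiField (phase (θ s) (fun i => p s i - W.Dc i * W.avgFrequency))) s := by
  have hquot : ∀ i j, (p s i - W.Dc i * W.avgFrequency) / W.Dc i
      - (p s j - W.Dc j * W.avgFrequency) / W.Dc j = p s i / W.Dc i - p s j / W.Dc j := by
    intro i j
    rw [sub_div, sub_div, mul_div_cancel_left₀ _ (hD i), mul_div_cancel_left₀ _ (hD j)]
    ring
  rw [hasDerivAt_pi]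
  intro kk
  cases kk with
  | inl i =>
    obtain ⟨hθ', _⟩ := hsol s i
    have hval : W.dapiField (phase (θ s) (fun i => p s i - W.Dc i * W.avgFrequency)) (Sum.inl i)
        = (W.Pstar i - p s i - W.injection (θ s) i) / W.Dc i := by
      simp only [dapiField, phase, Sum.elim_inl, Sum.elim_inr, DroopNetwork.auxField,
        DroopNetwork.shiftedInjection]
      rw [← sub_div]
      congr 1
      ring
    rw [hval]
    simpa [phase] using hθ'
  | inr i =>
    obtain ⟨_, hp'⟩ := hsol s i
    have hval : W.dapiField (phase (θ s) (fun i => p s i - W.Dc i * W.avgFrequency)) (Sum.inr i)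
        = (W.Pstar i - p s i - W.injection (θ s) i
            - ∑ j, W.comm i j * (p s i / W.Dc i - p s j / W.Dc j)) / W.kgain i := by
      simp only [dapiField, phase, Sum.elim_inl, Sum.elim_inr, hquot]
      rw [show (fun j => θ s j) = θ s from rfl, dc_mul_auxField hD, DroopNetwork.shiftedInjection]
      congr 1
      ring
    rw [hval]
    simpa [phase] using hp'

/-- **SPDB2013 Theorem 8 (ii), stability clause, all-inverter network, certificate form — the
equilibrium `(θ*, p* = Dω_avg)` of the DAPI closed loop is locally exponentially stable modulo the
uniform rotation of the angles.**  Hypotheses: `D_i > 0`, `k_i > 0`, `|Y|` symmetric, symmetric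
communication weights `c`; `θ*` an (Aux)-equilibrium (the angle array of Theorem 2's synchronized
solution, `P*_i − D_iω_avg = P_e,i(θ*)`); PSD + kernel certificates for the linearised network form
`u ↦ Σ_i u_i Σ_j a_ij cos(θ*_i − θ*_j)(u_i − u_j)` (e.g. the arc `θ* ∈ Δ_G(γ)`, `γ < π/2`:
`DroopNetwork.posCurvature_of_arc`) and for the communication Laplacian (e.g. `c ≥ 0` connected:
`commForm_certificate_of_connected`).  Conclusion: `ρ, k, λ > 0` such that every solution `(θ, p)`
(`IsSolutionAt` at every time) with `‖(θ(0) − θ*, p(0) − Dω_avg)‖ < ρ` satisfies for all `t ≥ 0`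
`‖(θ(t) − (θ* + c𝟙), p(t) − Dω_avg)‖ ≤ k‖(θ(0) − (θ* + c𝟙), p(0) − Dω_avg)‖e^{−λt}`,
`c = (Σ_i D_i(θ_i(0) − θ*_i) − Σ_i k_i(p_i(0) − D_iω_avg))/Σ_i D_i` (sup norm on `Fin n ⊕ Fin n`).
MODEL: droop-controlled inverters with the DAPI secondary loop, `V_L = ∅` (no load nodes),
lossless, constant voltages; `ρ, k, λ` existential.  NOT typed here: load nodes (the DAE), the
equivalence (i) ⇔ (ii) (existence/uniqueness of `θ*` is Theorem 2, `DroopControlledInverters.lean`),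
the power-sharing clause.
[cite: SimpsonporcoDorflerBullo2013, Theorem 8 (ii) («a locally exponentially stable and unique
equilibrium `(θ*, p*) ∈ Δ_G(γ) × ℝ^{|V_I|}` … `p*_i = D_iω_avg`») and App. C] -/
theorem equilibrium_locally_expStable_of_certificates (hD : ∀ i, 0 < W.Dc i)
    (hk : ∀ i, 0 < W.kgain i) (hY : ∀ i j, W.Yabs i j = W.Yabs j i)
    (hcs : ∀ i j, W.comm i j = W.comm j i) {θs : Fin n → ℝ} (hθs : W.IsAuxEquilibrium θs)
    (hpsd : ∀ u : Fin n → ℝ, 0 ≤ ∑ i, u i * ∑ j, W.linWeight θs i j * (u i - u j))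
    (hker : ∀ u : Fin n → ℝ, ∑ i, u i * ∑ j, W.linWeight θs i j * (u i - u j) = 0 →
      ∃ a : ℝ, u = fun _ => a)
    (hcpsd : ∀ u : Fin n → ℝ, 0 ≤ ∑ i, u i * ∑ j, W.comm i j * (u i - u j))
    (hcker : ∀ u : Fin n → ℝ, ∑ i, u i * ∑ j, W.comm i j * (u i - u j) = 0 →
      ∃ a : ℝ, u = fun _ => a) :
    ∃ ρ > 0, ∃ k > 0, ∃ lam > 0, ∀ θ p : ℝ → Fin n → ℝ, (∀ t, W.IsSolutionAt θ p t) →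
      ‖phase (θ 0 - θs) (fun i => p 0 i - W.Dc i * W.avgFrequency)‖ < ρ →
      ∀ t : ℝ, 0 ≤ t →
        ‖phase (fun i => θ t i - (θs i + (∑ j, W.Dc j * (θ 0 j - θs j)
              - ∑ j, W.kgain j * (p 0 j - W.Dc j * W.avgFrequency)) / ∑ j, W.Dc j))
            (fun i => p t i - W.Dc i * W.avgFrequency)‖
          ≤ k * ‖phase (fun i => θ 0 i - (θs i + (∑ j, W.Dc j * (θ 0 j - θs j)
              - ∑ j, W.kgain j * (p 0 j - W.Dc j * W.avgFrequency)) / ∑ j, W.Dc j))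
            (fun i => p 0 i - W.Dc i * W.avgFrequency)‖ * Real.exp (-lam * t) := by
  obtain ⟨ρ, hρ, k, hk', lam, hlam, H⟩ :=
    expStable_within_leaf hD hk hY hcs hθs hpsd hker hcpsd hcker
  have hD0 : ∀ i, W.Dc i ≠ 0 := fun i => (hD i).ne'
  have hK0 : 0 ≤ (∑ i, W.Dc i + ∑ i, W.kgain i) / ∑ i, W.Dc i :=
    div_nonneg (add_nonneg (Finset.sum_nonneg fun i _ => (hD i).le)
      (Finset.sum_nonneg fun i _ => (hk i).le)) (Finset.sum_nonneg fun i _ => (hD i).le)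
  refine ⟨ρ / (1 + (∑ i, W.Dc i + ∑ i, W.kgain i) / ∑ i, W.Dc i), by positivity, k, hk', lam, hlam,
    fun θ p hsol h0 t ht => ?_⟩
  have Hmod := expStable_modRotation_of_within_leaf hD hk H
  set X : ℝ → Fin n ⊕ Fin n → ℝ :=
    fun s => phase (θ s) (fun i => p s i - W.Dc i * W.avgFrequency) with hXdef
  have hXsol : ∀ s ∈ Icc 0 t, HasDerivWithinAt X (W.dapiField (X s)) (Icc 0 t) s :=
    fun s _ => (hasDerivAt_phase_of_isSolutionAt hD0 hsol s).hasDerivWithinAt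
  have hdev : X 0 - phase θs (fun _ => 0)
      = phase (θ 0 - θs) (fun i => p 0 i - W.Dc i * W.avgFrequency) := by
    funext kk
    cases kk with
    | inl i => simp [hXdef, phase]
    | inr i => simp [hXdef, phase]
  have hc : W.weights ⬝ᵥ (X 0 - phase θs (fun _ => 0))
      = ∑ j, W.Dc j * (θ 0 j - θs j) - ∑ j, W.kgain j * (p 0 j - W.Dc j * W.avgFrequency) := by
    rw [hdev]
    simp [dotProduct, Fintype.sum_sum_type, weights, phase, Finset.sum_neg_distrib]
    ring
  have key := Hmod X t hXsol (by rw [hdev]; exact h0) t ⟨ht, le_rfl⟩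
  rw [hc] at key
  have hshape : ∀ s, (X s - fun kk => phase θs (fun _ => 0) kk
      + (∑ j, W.Dc j * (θ 0 j - θs j) - ∑ j, W.kgain j * (p 0 j - W.Dc j * W.avgFrequency))
        / (∑ i, W.Dc i) * rot kk)
      = phase (fun i => θ s i - (θs i + (∑ j, W.Dc j * (θ 0 j - θs j)
          - ∑ j, W.kgain j * (p 0 j - W.Dc j * W.avgFrequency)) / ∑ j, W.Dc j))
        (fun i => p s i - W.Dc i * W.avgFrequency) := fun s => by
    funext kk
    cases kk with
    | inl i => simp [hXdef, phase, rot]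
    | inr i => simp [hXdef, phase, rot]
  rw [hshape t, hshape 0] at key
  exact key

/-- **Theorem 8 (ii), stability clause, with the printed hypotheses**: `θ* ∈ Δ_G(γ)`, `γ < π/2`
(`|θ*_i − θ*_j| < π/2` across every coupled pair), couplings `a_ij ≥ 0` with a connected coupling
graph, and a connected communication graph with weights `c_ij ≥ 0`.
[cite: SimpsonporcoDorflerBullo2013, Theorem 8 (ii) and App. C; §3 proof of Theorem 2 (b)] -/
theorem equilibrium_locally_expStable (hD : ∀ i, 0 < W.Dc i) (hk : ∀ i, 0 < W.kgain i)
    (hY : ∀ i j, W.Yabs i j = W.Yabs j i) (ha : ∀ i j, 0 ≤ W.a i j)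
    (hconn : ClassicalModel.CouplingConnected W.a)
    (hcs : ∀ i j, W.comm i j = W.comm j i) (hc0 : ∀ i j, 0 ≤ W.comm i j)
    (hcconn : ClassicalModel.CouplingConnected W.comm) {θs : Fin n → ℝ}
    (hθs : W.IsAuxEquilibrium θs) (harc : ∀ i j, i ≠ j → 0 < W.a i j → |θs i - θs j| < Real.pi / 2) :
    ∃ ρ > 0, ∃ k > 0, ∃ lam > 0, ∀ θ p : ℝ → Fin n → ℝ, (∀ t, W.IsSolutionAt θ p t) →
      ‖phase (θ 0 - θs) (fun i => p 0 i - W.Dc i * W.avgFrequency)‖ < ρ →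
      ∀ t : ℝ, 0 ≤ t →
        ‖phase (fun i => θ t i - (θs i + (∑ j, W.Dc j * (θ 0 j - θs j)
              - ∑ j, W.kgain j * (p 0 j - W.Dc j * W.avgFrequency)) / ∑ j, W.Dc j))
            (fun i => p t i - W.Dc i * W.avgFrequency)‖
          ≤ k * ‖phase (fun i => θ 0 i - (θs i + (∑ j, W.Dc j * (θ 0 j - θs j)
              - ∑ j, W.kgain j * (p 0 j - W.Dc j * W.avgFrequency)) / ∑ j, W.Dc j))
            (fun i => p 0 i - W.Dc i * W.avgFrequency)‖ * Real.exp (-lam * t) := by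
  obtain ⟨hpsd, hker⟩ :=
    DroopNetwork.posCurvature_of_arc (N := W.toDroopNetwork) ha hconn hY harc
  obtain ⟨hcpsd, hcker⟩ := commForm_certificate_of_connected hcs hc0 hcconn
  exact equilibrium_locally_expStable_of_certificates hD hk hY hcs hθs hpsd hker hcpsd hcker

end DAPINetwork

end Literature.MathematicalPhysics.PowerSystems

end
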